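import Mathlib
import HarnessLib
import Summits.NavierStokesRegularity.NavierStokesRegularity.Theorems.HalfSpaceWindowDoorCirculationCarryingRigidityEddyTorqueLiouville

/-!
# Route `HalfSpaceWindowDoor`, crux `CirculationCarryingRigidity` (stmt-NavierStokesRegularity-25311) — the two strata of the
# eddy-torque census theorem: AXISYMMETRIC SWIRL (`ℛ ≡ 0`; new dead stratum) and the CIRCLE-AVERAGED CONE (g3's stratum, recovered)

Line `eddy_torque` (LEAD ns-hsw-p1 g4), sequel of `…EddyTorqueLiouville` (closed-hemisphere axis-Type-I profiles with
`|ℛ| ≤ A/(r+√(−s))·∮ω₃ dl` are poloidal; `ℛ = ∮[(v_z − v̄_z)ω_r − (v_r − v̄_r)ω₃] dl` = AxisTwistDoor `…Defs.remainder`).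

* STRATUM 1 (NEW): **axisymmetric swirl kills the remainder** (`remainder_eq_zero_of_isAxisymmetricScalar_swirl`).  If the swirl
  `x₀v₁ − x₁v₀ = r v_θ` of a `C¹` slice is an axisymmetric scalar — the azimuthal velocity does not depend on the angle, while
  `v_r`, `v_z` may depend on it arbitrarily (TWISTED profiles, `|ω_h| ≫ ω₃`, included) — then `ℛ ≡ 0` on every axis circle.
  Mechanism (circle calculus of AxisTwistDoor `…CircleStokes`/`…CylFrame`): `ω_r r = ∂_θ v_z − ∂_z(r v_θ)` (`inner_curl_eR_mul`),
  `ω₃ r = ∂_r(r v_θ) − ∂_θ v_r` (`key_identity`), and `∂_z(r v_θ)`, `∂_r(r v_θ)` are CONSTANT on the circle (chain rule for an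
  axisymmetric scalar), so `ℛ = ∮(v_z − v̄_z)∂_θ v_z + ∮(v_r − v̄_r)∂_θ v_r − c_z∮(v_z − v̄_z) − c_r∮(v_r − v̄_r) = 0` by
  periodicity.  Census corollary `inner_curl_e3_eq_zero_of_axisTypeI_axisymmetricSwirl`: closed-hemisphere axis-Type-I profiles
  of the door class with axisymmetric swirl are POLOIDAL (hence also swirl-free, `Γ = 2π r v_θ ≡ 0`) — a dead stratum strictly
  containing KNSS's axisymmetric one and not contained in any cone stratum.
* STRATUM 2 (g3 recovered): **the circle-averaged cone implies the eddy-torque condition** (`abs_remainder_le_of_cone`): under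
  the sign and the axis-Type-I bound, `|ℛ| ≤ 2B(∮ω₃ + ∮|ω_h|)` with `B = D/(r+√(−s))` (`abs_remainder_le`; `|v − v̄| ≤ 2B` on the
  circle), so `∮|ω_h| ≤ K∮ω₃` gives `|ℛ| ≤ 2(1+K)D/(r+√(−s))·∮ω₃`, and `…EddyTorqueLiouville` applies
  (`inner_curl_e3_eq_zero_of_axisTypeI_globalCone_via_eddyTorque`; g3's `…AxisTypeILiouville` proves the stronger `v ≡ 0` there —
  the point is only the INCLUSION {cone} ⊂ {eddy torque slaved to ∮ω₃}).

Seat ns-hsw-p1 g4 (LEAD of 25311, cell pub-ns-dss).  WHAT THIS IS NOT: not a statement about Navier–Stokes regularity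
(Clay A): Liouville-type statements about HYPOTHETICAL blow-up profiles; the crux, its stub and NS regularity remain OPEN;
helper `--supports` 25311.
-/

noncomputable section

-- the summit and its single sub-problem share the name (CONVENTIONS §1), as in every Theorems file
set_option linter.dupNamespace false

namespace Summit.NavierStokesRegularity.NavierStokesRegularity.Theorems.HalfSpaceWindowDoorCirculationCarryingRigidityEddyTorqueStrata

open MeasureTheory Set Function Filter Topology TopologicalSpace InnerProductSpace WithLp Metric
open scoped RealInnerProductSpace ContDiff Classical
open Literature.Analysis Literature.Analysis.FluidPDE
open Summit.NavierStokesRegularity.NavierStokesRegularity.Theorems.AxisTwistDoorAveragedConeLiouvilleDefs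
  (cylPt eT e3 circ vortCirc radVortCirc tiltCirc circleTerm meanR meanZ remainder SignE3 GlobalCone)
open Summit.NavierStokesRegularity.NavierStokesRegularity.Theorems.AveragedConeLiouville.CircleStokes
  (continuous_eR continuous_eT inner_e3 cylPt_two_pi eR_two_pi hasDerivAt_radial_theta key_identity)
open Summit.NavierStokesRegularity.NavierStokesRegularity.Theorems.AveragedConeLiouville.CircMonotone
  (vortCirc_zero tiltCirc_zero vortCirc_nonneg)
open Summit.NavierStokesRegularity.NavierStokesRegularity.Theorems.AveragedConeLiouville.ShellBookkeeping (cylRadius_cylPt)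
open Summit.NavierStokesRegularity.NavierStokesRegularity.Theorems.AxisTwistDoorAveragedConeLiouvilleCylFrame
  (inner_eR inner_eT abs_inner_eR_le abs_inner_e3_le abs_inner_eR_le_norm_horizontal continuous_horizontal
    abs_integral_le_const_mul_add continuous_cylPt_θ hasDerivAt_slice_comp_cylPt_θ inner_curl_eR_mul)
open Summit.NavierStokesRegularity.NavierStokesRegularity.Theorems.HalfSpaceWindowDoorCirculationCarryingRigidityAxisCirculation
  (rotZ_cylPt isSmoothSpaceTimeOn_of_class)
open Summit.NavierStokesRegularity.NavierStokesRegularity.Theorems.HalfSpaceWindowDoorCirculationCarryingRigidityAxisCirculationDynamics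
  (tiltCirc_le_of_globalCone)
open Summit.NavierStokesRegularity.NavierStokesRegularity.Theorems.HalfSpaceWindowDoorCirculationCarryingRigidityAxisTypeILiouville
  (axisBound_nonneg norm_le_on_circle_of_axisBound)
open Summit.NavierStokesRegularity.NavierStokesRegularity.Theorems.HalfSpaceWindowDoorCirculationCarryingRigidityEddyTorqueLiouville
  (inner_curl_e3_eq_zero_of_axisTypeI_remainder_le inner_curl_e3_eq_zero_of_axisTypeI_remainder_eq_zero)

-- AxisTwistDoor's angular radial unit vector `e_r(θ)` is its `…Defs.eR`; renamed on opening to avoid the clash with the radial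
-- unit vector FIELD `Literature.Analysis.FluidPDE.eR`
open Summit.NavierStokesRegularity.NavierStokesRegularity.Theorems.AxisTwistDoorAveragedConeLiouvilleDefs renaming eR → eRang

variable {C D K : ℝ} {v : ℝ → EuclideanSpace ℝ (Fin 3) → EuclideanSpace ℝ (Fin 3)}

/-! ### Stratum 1: AXISYMMETRIC SWIRL ⇒ the fluctuation remainder vanishes -/

/-- The rotation generator at a circle point: `J(cylPt r θ z) = r e_θ(θ)`. -/
theorem rotGen_cylPt (r θ z : ℝ) : rotGen (cylPt r θ z) = r • eT θ := by
  ext i; fin_cases i <;> simp [rotGen, cylPt, eT]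

/-- `J e_r(θ) = e_θ(θ)`. -/
theorem rotGen_eRang (θ : ℝ) : rotGen (eRang θ) = eT θ := by
  ext i; fin_cases i <;> simp [rotGen, eT, AxisTwistDoorAveragedConeLiouvilleDefs.eR]

/-- `J e₃ = 0`. -/
theorem rotGen_e3 : rotGen e3 = 0 := by
  ext i; fin_cases i <;> simp [rotGen, e3]

/-- `R_θ e₃ = e₃`. -/
theorem rotZ_e3 (θ : ℝ) : rotZ θ e3 = e3 := by
  ext i; fin_cases i <;> simp [rotZ, e3]

/-- `R_θ e_r(0) = e_r(θ)`. -/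
theorem rotZ_eRang_zero (θ : ℝ) : rotZ θ (eRang 0) = eRang θ := by
  ext i; fin_cases i <;> simp [rotZ, AxisTwistDoorAveragedConeLiouvilleDefs.eR]

/-- **The axial derivative of the swirl on a circle**: `∂_z(r v_θ)(cylPt r θ z) = r ⟪Dv e₃, e_θ⟫`. -/
theorem fderiv_swirl_e3 {u : EuclideanSpace ℝ (Fin 3) → EuclideanSpace ℝ (Fin 3)} (hu : Differentiable ℝ u) (r θ z : ℝ) :
    fderiv ℝ (swirl u) (cylPt r θ z) e3 = r * ⟪fderiv ℝ u (cylPt r θ z) e3, eT θ⟫_ℝ := by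
  rw [fderiv_swirl_apply (hu _), rotGen_cylPt, rotGen_e3, inner_zero_left, add_zero, real_inner_smul_left,
    real_inner_comm (fderiv ℝ u (cylPt r θ z) e3) (eT θ)]

/-- **The radial derivative of the swirl on a circle**: `∂_r(r v_θ)(cylPt r θ z) = ⟪Dv e_r, e_θ⟫ r + ⟪v, e_θ⟫`. -/
theorem fderiv_swirl_eRang {u : EuclideanSpace ℝ (Fin 3) → EuclideanSpace ℝ (Fin 3)} (hu : Differentiable ℝ u) (r θ z : ℝ) :
    fderiv ℝ (swirl u) (cylPt r θ z) (eRang θ) =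
      ⟪fderiv ℝ u (cylPt r θ z) (eRang θ), eT θ⟫_ℝ * r + ⟪u (cylPt r θ z), eT θ⟫_ℝ := by
  rw [fderiv_swirl_apply (hu _), rotGen_cylPt, rotGen_eRang, real_inner_smul_left,
    real_inner_comm (fderiv ℝ u (cylPt r θ z) (eRang θ)) (eT θ), real_inner_comm (u (cylPt r θ z)) (eT θ)]
  ring

/-- Chain rule for an axisymmetric scalar: `DS(R_θ x)[R_θ w] = DS(x)[w]` (the tree's
`IsAxisymmetricScalar.fderiv_rotZ_apply_rotZ`, re-proved to keep the imports of this file small). -/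
theorem fderiv_rotZ_apply_rotZ_of_isAxisymmetricScalar {S : EuclideanSpace ℝ (Fin 3) → ℝ} (hax : IsAxisymmetricScalar S)
    (hd : Differentiable ℝ S) (θ : ℝ) (x w : EuclideanSpace ℝ (Fin 3)) :
    fderiv ℝ S (rotZ θ x) (rotZ θ w) = fderiv ℝ S x w := by
  have hcomp : (fun y => S (rotZL θ y)) = S := funext fun y => hax θ y
  have hl : HasFDerivAt (fun y => S (rotZL θ y)) ((fderiv ℝ S (rotZ θ x)).comp (rotZL θ)) x :=
    (hd (rotZL θ x)).hasFDerivAt.comp x (rotZL θ).hasFDerivAt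
  rw [hcomp] at hl
  rw [hl.fderiv, ContinuousLinearMap.comp_apply, rotZL_apply]

/-- For an AXISYMMETRIC swirl, `∂_z(r v_θ)` is constant on every axis circle. -/
theorem fderiv_swirl_e3_const {u : EuclideanSpace ℝ (Fin 3) → EuclideanSpace ℝ (Fin 3)} (hu : Differentiable ℝ u)
    (hax : IsAxisymmetricScalar (swirl u)) (r θ z : ℝ) :
    fderiv ℝ (swirl u) (cylPt r θ z) e3 = fderiv ℝ (swirl u) (cylPt r 0 z) e3 := by
  have hdS : Differentiable ℝ (swirl u) := fun x => differentiableAt_swirl (hu x)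
  have h := fderiv_rotZ_apply_rotZ_of_isAxisymmetricScalar hax hdS θ (cylPt r 0 z) e3
  rwa [rotZ_cylPt, zero_add, rotZ_e3] at h

/-- For an AXISYMMETRIC swirl, `∂_r(r v_θ)` is constant on every axis circle. -/
theorem fderiv_swirl_eRang_const {u : EuclideanSpace ℝ (Fin 3) → EuclideanSpace ℝ (Fin 3)} (hu : Differentiable ℝ u)
    (hax : IsAxisymmetricScalar (swirl u)) (r θ z : ℝ) :
    fderiv ℝ (swirl u) (cylPt r θ z) (eRang θ) = fderiv ℝ (swirl u) (cylPt r 0 z) (eRang 0) := by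
  have hdS : Differentiable ℝ (swirl u) := fun x => differentiableAt_swirl (hu x)
  have h := fderiv_rotZ_apply_rotZ_of_isAxisymmetricScalar hax hdS θ (cylPt r 0 z) (eRang 0)
  rwa [rotZ_cylPt, zero_add, rotZ_eRang_zero] at h

/-- `∫₀^{2π} (f − f̄) = 0` bookkeeping: `∫₀^{2π} (f θ − (2π)⁻¹∫₀^{2π} f) dθ = 0`. -/
theorem integral_sub_mean_eq_zero {f : ℝ → ℝ} (hf : Continuous f) :
    ∫ θ in (0 : ℝ)..(2 * Real.pi), (f θ - (2 * Real.pi)⁻¹ * ∫ φ in (0 : ℝ)..(2 * Real.pi), f φ) = 0 := by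
  rw [intervalIntegral.integral_sub (hf.intervalIntegrable _ _) intervalIntegrable_const, intervalIntegral.integral_const,
    sub_zero, smul_eq_mul]
  have hπ : (2 * Real.pi) ≠ 0 := by positivity
  rw [← mul_assoc, mul_inv_cancel₀ hπ, one_mul, sub_self]

/-- `∫₀^{2π} (f − c) f' = 0` for a `2π`-periodic `C¹` function (`= [(f − c)²/2]₀^{2π}`). -/
theorem integral_sub_const_mul_deriv_eq_zero {f f' : ℝ → ℝ} (hf : ∀ θ, HasDerivAt f (f' θ) θ) (hf' : Continuous f')
    (hper : f (2 * Real.pi) = f 0) (c : ℝ) :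
    ∫ θ in (0 : ℝ)..(2 * Real.pi), (f θ - c) * f' θ = 0 := by
  have hG : ∀ θ ∈ uIcc (0 : ℝ) (2 * Real.pi),
      HasDerivAt (fun θ' => f θ' * f θ' / 2 - c * f θ') ((f θ - c) * f' θ) θ := by
    intro θ _
    have h := (((hf θ).mul (hf θ)).div_const 2).sub ((hf θ).const_mul c)
    refine h.congr_deriv ?_
    ring
  have hfc : Continuous f := continuous_iff_continuousAt.2 fun θ => (hf θ).continuousAt
  have hint : IntervalIntegrable (fun θ => (f θ - c) * f' θ) volume 0 (2 * Real.pi) :=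
    ((hfc.sub continuous_const).mul hf').intervalIntegrable _ _
  rw [intervalIntegral.integral_eq_sub_of_hasDerivAt hG hint, hper, sub_self]

/-- **STRATUM 1 — AXISYMMETRIC SWIRL KILLS THE REMAINDER.**  If the swirl `x₀v₁ − x₁v₀ = r v_θ` of a `C¹` slice is an
axisymmetric scalar (the azimuthal velocity `v_θ` does not depend on the angle; `v_r`, `v_z` arbitrary), then the
fluctuation remainder vanishes on every axis circle: `ℛ(r,z,s) = 0`.  Mechanism: on the circle
`ω_r r = ∂_θ v_z − ∂_z(r v_θ)` and `ω₃ r = ∂_r(r v_θ) − ∂_θ v_r` with `∂_z(r v_θ)`, `∂_r(r v_θ)` CONSTANT in `θ`, so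
`ℛ = ∮(v_z − v̄_z)∂_θ v_z + ∮(v_r − v̄_r)∂_θ v_r − const·∮(v_z − v̄_z) − const·∮(v_r − v̄_r) = 0` by periodicity. -/
theorem remainder_eq_zero_of_isAxisymmetricScalar_swirl {s : ℝ} (hv : ContDiff ℝ 1 (v s))
    (hax : IsAxisymmetricScalar (swirl (v s))) (r z : ℝ) : remainder v r z s = 0 := by
  have hd : Differentiable ℝ (v s) := hv.differentiable one_ne_zero
  set u := v s with hu
  -- the two velocity components on the circle and their angular derivatives
  set a : ℝ → ℝ := fun θ => ⟪u (cylPt r θ z), e3⟫_ℝ with ha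
  set a' : ℝ → ℝ := fun θ => fderiv ℝ u (cylPt r θ z) (r • eT θ) 2 with ha'
  set b : ℝ → ℝ := fun θ => ⟪u (cylPt r θ z), eRang θ⟫_ℝ with hb
  set b' : ℝ → ℝ := fun θ => ⟪u (cylPt r θ z), eT θ⟫_ℝ + ⟪fderiv ℝ u (cylPt r θ z) (r • eT θ), eRang θ⟫_ℝ with hb'
  have haD : ∀ θ, HasDerivAt a (a' θ) θ := by
    intro θ
    have h := (hasDerivAt_slice_comp_cylPt_θ hd r θ z).inner ℝ (hasDerivAt_const θ e3)
    simpa [ha, ha', inner_e3] using h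
  have hbD : ∀ θ, HasDerivAt b (b' θ) θ := fun θ => hasDerivAt_radial_theta hv r θ z
  -- the two constants `∂_z(r v_θ)` and `∂_r(r v_θ)` on the circle
  set cz : ℝ := fderiv ℝ (swirl u) (cylPt r 0 z) e3 with hcz
  set cr : ℝ := fderiv ℝ (swirl u) (cylPt r 0 z) (eRang 0) with hcr
  have hP1 : ∀ θ, ⟪curl u (cylPt r θ z), eRang θ⟫_ℝ * r = a' θ - cz := by
    intro θ
    rw [inner_curl_eR_mul u r θ z, hcz, ← fderiv_swirl_e3_const hd hax r θ z, fderiv_swirl_e3 hd]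
  have hP2 : ∀ θ, ⟪curl u (cylPt r θ z), e3⟫_ℝ * r = cr - b' θ := by
    intro θ
    have hk := key_identity (w := u) r θ z
    rw [hcr, ← fderiv_swirl_eRang_const hd hax r θ z, fderiv_swirl_eRang hd]
    simp only [hb']
    linarith
  -- continuity
  have hp := continuous_cylPt_θ r z
  have huc : Continuous fun θ => u (cylPt r θ z) := hv.continuous.comp hp
  have hDc : Continuous fun θ => fderiv ℝ u (cylPt r θ z) := (hv.continuous_fderiv one_ne_zero).comp hp
  have hac : Continuous a := huc.inner continuous_const
  have hbc : Continuous b := huc.inner continuous_eR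
  have ha'c : Continuous a' :=
    (EuclideanSpace.proj (2 : Fin 3) : EuclideanSpace ℝ (Fin 3) →L[ℝ] ℝ).continuous.comp
      (hDc.clm_apply (continuous_eT.const_smul r))
  have hb'c : Continuous b' := (huc.inner continuous_eT).add ((hDc.clm_apply (continuous_eT.const_smul r)).inner continuous_eR)
  -- rewrite the remainder integrand
  set Z := meanZ v r z s with hZ
  set R := meanR v r z s with hR
  have hpt : ∀ θ, ((⟪v s (cylPt r θ z), e3⟫_ℝ - Z) * ⟪curl (v s) (cylPt r θ z), eRang θ⟫_ℝ
        - (⟪v s (cylPt r θ z), eRang θ⟫_ℝ - R) * ⟪curl (v s) (cylPt r θ z), e3⟫_ℝ) * r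
      = ((a θ - Z) * a' θ + (b θ - R) * b' θ) - (cz * (a θ - Z) + cr * (b θ - R)) := by
    intro θ
    have e1 : ((⟪v s (cylPt r θ z), e3⟫_ℝ - Z) * ⟪curl (v s) (cylPt r θ z), eRang θ⟫_ℝ
        - (⟪v s (cylPt r θ z), eRang θ⟫_ℝ - R) * ⟪curl (v s) (cylPt r θ z), e3⟫_ℝ) * r
        = (a θ - Z) * (⟪curl u (cylPt r θ z), eRang θ⟫_ℝ * r) - (b θ - R) * (⟪curl u (cylPt r θ z), e3⟫_ℝ * r) := by
      simp only [ha, hb, hu]; ring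
    rw [e1, hP1 θ, hP2 θ]; ring
  have hI1 : ∫ θ in (0 : ℝ)..(2 * Real.pi), (a θ - Z) * a' θ = 0 :=
    integral_sub_const_mul_deriv_eq_zero haD ha'c (by simp only [ha, cylPt_two_pi]) Z
  have hI2 : ∫ θ in (0 : ℝ)..(2 * Real.pi), (b θ - R) * b' θ = 0 :=
    integral_sub_const_mul_deriv_eq_zero hbD hb'c (by simp only [hb, cylPt_two_pi, eR_two_pi]) R
  have hI3 : ∫ θ in (0 : ℝ)..(2 * Real.pi), (a θ - Z) = 0 := by
    have h := integral_sub_mean_eq_zero hac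
    simpa only [hZ, meanZ, ha] using h
  have hI4 : ∫ θ in (0 : ℝ)..(2 * Real.pi), (b θ - R) = 0 := by
    have h := integral_sub_mean_eq_zero hbc
    simpa only [hR, meanR, hb] using h
  have i1 : IntervalIntegrable (fun θ => (a θ - Z) * a' θ) volume 0 (2 * Real.pi) :=
    ((hac.sub continuous_const).mul ha'c).intervalIntegrable _ _
  have i2 : IntervalIntegrable (fun θ => (b θ - R) * b' θ) volume 0 (2 * Real.pi) :=
    ((hbc.sub continuous_const).mul hb'c).intervalIntegrable _ _
  have i3 : IntervalIntegrable (fun θ => cz * (a θ - Z)) volume 0 (2 * Real.pi) :=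
    (continuous_const.mul (hac.sub continuous_const)).intervalIntegrable _ _
  have i4 : IntervalIntegrable (fun θ => cr * (b θ - R)) volume 0 (2 * Real.pi) :=
    (continuous_const.mul (hbc.sub continuous_const)).intervalIntegrable _ _
  unfold remainder
  rw [intervalIntegral.integral_congr (fun θ _ => hpt θ), intervalIntegral.integral_sub (i1.add i2) (i3.add i4),
    intervalIntegral.integral_add i1 i2, intervalIntegral.integral_add i3 i4, intervalIntegral.integral_const_mul,
    intervalIntegral.integral_const_mul, hI1, hI2, hI3, hI4]
  ring

/-- **Census corollary — AXISYMMETRIC-SWIRL PROFILES ARE POLOIDAL.**  A profile of the door's Type-I ancient Oseen-mild class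
with the axis-Type-I bound and the closed-hemisphere sign whose swirl `r v_θ` is axisymmetric on every slice (the radial and
vertical velocities may depend on the angle arbitrarily — twisted profiles included) is poloidal: `⟪curl v, e₃⟫ ≡ 0`.  (Then
`Γ = 2π r v_θ ≡ 0` as well: such a profile is swirl-free.)  Strictly contains KNSS's axisymmetric stratum. -/
theorem inner_curl_e3_eq_zero_of_axisTypeI_axisymmetricSwirl (C D : ℝ)
    (v : ℝ → EuclideanSpace ℝ (Fin 3) → EuclideanSpace ℝ (Fin 3))
    (hrate : HasTypeITimeDecay C v)
    (hcont : ContinuousOn (uncurry v) (Iio (0 : ℝ) ×ˢ univ))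
    (hmild : ∀ s t : ℝ, s < t → t < 0 → ∀ x,
      v t x = UnboundedOperators.heatExtension (v s) (t - s) x - oseenDuhamel 1 s v v t x)
    (hdiv : ∀ t < 0, VectorCalculus.IsDivFree (v t))
    (hDax : ∀ t < 0, ∀ x : EuclideanSpace ℝ (Fin 3), ‖v t x‖ ≤ D / (cylRadius x + Real.sqrt (-t)))
    (hsign : ∀ s < 0, ∀ y, 0 ≤ ⟪curl (v s) y, (EuclideanSpace.single (2 : Fin 3) (1 : ℝ))⟫_ℝ)
    (hax : ∀ s < 0, IsAxisymmetricScalar (swirl (v s))) :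
    ∀ s < 0, ∀ y, ⟪curl (v s) y, (EuclideanSpace.single (2 : Fin 3) (1 : ℝ))⟫_ℝ = 0 := by
  have hsm : IsSmoothSpaceTimeOn (Iio (0 : ℝ)) v := isSmoothSpaceTimeOn_of_class hrate hcont hmild hdiv
  refine inner_curl_e3_eq_zero_of_axisTypeI_remainder_eq_zero C D v hrate hcont hmild hdiv hDax hsign fun s hs r _ z => ?_
  have hv1 : ContDiff ℝ 1 (v s) := (hsm.contDiff_slice hs).of_le (by norm_cast)
  exact remainder_eq_zero_of_isAxisymmetricScalar_swirl hv1 (hax s hs) r z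

/-! ### Stratum 2: the CIRCLE-AVERAGED CONE implies the eddy-torque condition (g3's stratum recovered) -/

/-- The circle mean of a component bounded by `B` is bounded by `B`: `|v̄_z| ≤ B`. -/
theorem abs_meanZ_le {s r z B : ℝ} (hB : ∀ θ : ℝ, ‖v s (cylPt r θ z)‖ ≤ B) : |meanZ v r z s| ≤ B := by
  have hB0 : 0 ≤ B := (norm_nonneg _).trans (hB 0)
  have h : ‖∫ θ in (0 : ℝ)..(2 * Real.pi), ⟪v s (cylPt r θ z), e3⟫_ℝ‖ ≤ B * |2 * Real.pi - 0| :=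
    intervalIntegral.norm_integral_le_of_norm_le_const fun θ _ => by
      rw [Real.norm_eq_abs]; exact (abs_inner_e3_le _).trans (hB θ)
  rw [sub_zero, abs_of_pos (by positivity), Real.norm_eq_abs] at h
  rw [meanZ, abs_mul, abs_of_pos (by positivity), inv_mul_le_iff₀ (by positivity)]
  linarith

/-- `|v̄_r| ≤ B`. -/
theorem abs_meanR_le {s r z B : ℝ} (hB : ∀ θ : ℝ, ‖v s (cylPt r θ z)‖ ≤ B) : |meanR v r z s| ≤ B := by
  have hB0 : 0 ≤ B := (norm_nonneg _).trans (hB 0)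
  have h : ‖∫ θ in (0 : ℝ)..(2 * Real.pi), ⟪v s (cylPt r θ z), eRang θ⟫_ℝ‖ ≤ B * |2 * Real.pi - 0| :=
    intervalIntegral.norm_integral_le_of_norm_le_const fun θ _ => by
      rw [Real.norm_eq_abs]; exact (abs_inner_eR_le _ θ).trans (hB θ)
  rw [sub_zero, abs_of_pos (by positivity), Real.norm_eq_abs] at h
  rw [meanR, abs_mul, abs_of_pos (by positivity), inv_mul_le_iff₀ (by positivity)]
  linarith

/-- Pointwise bound of the remainder integrand under the sign: `|((v_z − Z)ω_r − (v_r − R)ω₃) r| ≤ 2B(ω₃ r + |ω_h| r)` when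
`|v| ≤ B`, `|Z|, |R| ≤ B`, `ω₃ ≥ 0`, `r ≥ 0`. -/
theorem abs_remainder_integrand_le (w q : EuclideanSpace ℝ (Fin 3)) {θ r B R Z : ℝ} (hr : 0 ≤ r)
    (hw : ‖w‖ ≤ B) (hRle : |R| ≤ B) (hZle : |Z| ≤ B) (hq : 0 ≤ ⟪q, e3⟫_ℝ) :
    |((⟪w, e3⟫_ℝ - Z) * ⟪q, eRang θ⟫_ℝ - (⟪w, eRang θ⟫_ℝ - R) * ⟪q, e3⟫_ℝ) * r| ≤
      2 * B * (⟪q, e3⟫_ℝ * r + ‖q - ⟪q, e3⟫_ℝ • e3‖ * r) := by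
  have h1 : |⟪w, eRang θ⟫_ℝ - R| ≤ 2 * B := by
    have := (abs_sub _ _).trans (add_le_add ((abs_inner_eR_le w θ).trans hw) hRle); linarith
  have h2 : |⟪w, e3⟫_ℝ - Z| ≤ 2 * B := by
    have := (abs_sub _ _).trans (add_le_add ((abs_inner_e3_le w).trans hw) hZle); linarith
  have h3 : |⟪q, eRang θ⟫_ℝ| ≤ ‖q - ⟪q, e3⟫_ℝ • e3‖ := abs_inner_eR_le_norm_horizontal q θ
  have hB : 0 ≤ B := (norm_nonneg w).trans hw
  rw [abs_mul, abs_of_nonneg hr]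
  have h4 : |(⟪w, e3⟫_ℝ - Z) * ⟪q, eRang θ⟫_ℝ - (⟪w, eRang θ⟫_ℝ - R) * ⟪q, e3⟫_ℝ| ≤
      2 * B * ‖q - ⟪q, e3⟫_ℝ • e3‖ + 2 * B * ⟪q, e3⟫_ℝ := by
    refine (abs_sub _ _).trans ?_
    rw [abs_mul, abs_mul, abs_of_nonneg hq]
    have h5 : |⟪w, e3⟫_ℝ - Z| * |⟪q, eRang θ⟫_ℝ| ≤ 2 * B * ‖q - ⟪q, e3⟫_ℝ • e3‖ :=
      mul_le_mul h2 h3 (abs_nonneg _) (by positivity)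
    have h6 : |⟪w, eRang θ⟫_ℝ - R| * ⟪q, e3⟫_ℝ ≤ 2 * B * ⟪q, e3⟫_ℝ := mul_le_mul_of_nonneg_right h1 hq
    linarith
  calc |(⟪w, e3⟫_ℝ - Z) * ⟪q, eRang θ⟫_ℝ - (⟪w, eRang θ⟫_ℝ - R) * ⟪q, e3⟫_ℝ| * r
      ≤ (2 * B * ‖q - ⟪q, e3⟫_ℝ • e3‖ + 2 * B * ⟪q, e3⟫_ℝ) * r := mul_le_mul_of_nonneg_right h4 hr
    _ = 2 * B * (⟪q, e3⟫_ℝ * r + ‖q - ⟪q, e3⟫_ℝ • e3‖ * r) := by ring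

/-- **`|ℛ| ≤ 2B (∮ω₃ dl + ∮|ω_h| dl)`** for a `C¹` slice with `ω₃ ≥ 0` and `‖v(s)‖ ≤ B` on the circle `S(r,z)`, `r ≥ 0`. -/
theorem abs_remainder_le {s r z B : ℝ} (hv : ContDiff ℝ 1 (v s)) (hsign : ∀ y, 0 ≤ ⟪curl (v s) y, e3⟫_ℝ)
    (hr : 0 ≤ r) (hB : ∀ θ : ℝ, ‖v s (cylPt r θ z)‖ ≤ B) :
    |remainder v r z s| ≤ 2 * B * (vortCirc v r z s + tiltCirc v r z s) := by
  have hp := continuous_cylPt_θ r z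
  have hvc : Continuous fun θ => v s (cylPt r θ z) := hv.continuous.comp hp
  have hωc : Continuous fun θ => curl (v s) (cylPt r θ z) := (continuous_curl hv).comp hp
  have hf : Continuous fun θ => ((⟪v s (cylPt r θ z), e3⟫_ℝ - meanZ v r z s) * ⟪curl (v s) (cylPt r θ z), eRang θ⟫_ℝ
      - (⟪v s (cylPt r θ z), eRang θ⟫_ℝ - meanR v r z s) * ⟪curl (v s) (cylPt r θ z), e3⟫_ℝ) * r :=
    ((((hvc.inner continuous_const).sub continuous_const).mul (hωc.inner continuous_eR)).sub
      (((hvc.inner continuous_eR).sub continuous_const).mul (hωc.inner continuous_const))).mul continuous_const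
  have hg1 : Continuous fun θ => ⟪curl (v s) (cylPt r θ z), e3⟫_ℝ * r := (hωc.inner continuous_const).mul continuous_const
  have hg2 : Continuous fun θ => ‖curl (v s) (cylPt r θ z) - ⟪curl (v s) (cylPt r θ z), e3⟫_ℝ • e3‖ * r :=
    ((continuous_horizontal.comp hωc).norm).mul continuous_const
  exact abs_integral_le_const_mul_add hf hg1 hg2 fun θ =>
    abs_remainder_integrand_le (v s (cylPt r θ z)) (curl (v s) (cylPt r θ z)) hr (hB θ) (abs_meanR_le hB)
      (abs_meanZ_le hB) (hsign (cylPt r θ z))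

/-- **STRATUM 2 — THE CIRCLE-AVERAGED CONE IMPLIES THE EDDY-TORQUE CONDITION**: under the sign, the axis-Type-I bound and
the slack-free circle-averaged cone `∮|ω_h| dl ≤ K ∮ω₃ dl` (constant `K ≥ 0`), `|ℛ(r,z,s)| ≤ 2(1+K)D/(r + √(−s)) · ∮ω₃ dl`
for `r > 0`, `s < 0`.  So the eddy-torque census theorem contains g3's `…AxisTypeILiouville` stratum. -/
theorem abs_remainder_le_of_cone (hsm : IsSmoothSpaceTimeOn (Iio (0 : ℝ)) v)
    (hDax : ∀ t < 0, ∀ x : EuclideanSpace ℝ (Fin 3), ‖v t x‖ ≤ D / (cylRadius x + Real.sqrt (-t))) (hsign : SignE3 v)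
    (hK : ∀ s < 0, ∀ r : ℝ, 0 ≤ r → ∀ z : ℝ, tiltCirc v r z s ≤ K * vortCirc v r z s)
    {s : ℝ} (hs : s < 0) {r : ℝ} (hr : 0 < r) (z : ℝ) :
    |remainder v r z s| ≤ 2 * (1 + K) * D / (r + Real.sqrt (-s)) * vortCirc v r z s := by
  have hv1 : ContDiff ℝ 1 (v s) := (hsm.contDiff_slice hs).of_le (by norm_cast)
  have hD0 : 0 ≤ D := axisBound_nonneg hDax
  have hsq : 0 < Real.sqrt (-s) := Real.sqrt_pos.2 (by linarith)
  have hB : ∀ θ : ℝ, ‖v s (cylPt r θ z)‖ ≤ D / (r + Real.sqrt (-s)) :=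
    fun θ => norm_le_on_circle_of_axisBound hDax hs hr.le θ z
  have h := abs_remainder_le hv1 (fun y => hsign s hs y) hr.le hB
  have hcone := hK s hs r hr.le z
  have hW : 0 ≤ vortCirc v r z s := vortCirc_nonneg v hsign hs hr.le z
  have hB0 : 0 ≤ D / (r + Real.sqrt (-s)) := by positivity
  calc |remainder v r z s| ≤ 2 * (D / (r + Real.sqrt (-s))) * (vortCirc v r z s + tiltCirc v r z s) := h
    _ ≤ 2 * (D / (r + Real.sqrt (-s))) * (vortCirc v r z s + K * vortCirc v r z s) := by
        exact mul_le_mul_of_nonneg_left (add_le_add le_rfl hcone) (by positivity)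
    _ = 2 * (1 + K) * D / (r + Real.sqrt (-s)) * vortCirc v r z s := by ring

/-- **Census corollary — the cone stratum through the eddy-torque theorem**: a closed-hemisphere axis-Type-I profile of the class
with the global slack-free circle-averaged cone (`GlobalCone`) is poloidal.  (g3's `…AxisTypeILiouville` proves the stronger
`v ≡ 0` on this stratum; the point here is only that the eddy-torque hypothesis CONTAINS the cone hypothesis.) -/
theorem inner_curl_e3_eq_zero_of_axisTypeI_globalCone_via_eddyTorque (C D : ℝ)
    (v : ℝ → EuclideanSpace ℝ (Fin 3) → EuclideanSpace ℝ (Fin 3))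
    (hrate : HasTypeITimeDecay C v)
    (hcont : ContinuousOn (uncurry v) (Iio (0 : ℝ) ×ˢ univ))
    (hmild : ∀ s t : ℝ, s < t → t < 0 → ∀ x,
      v t x = UnboundedOperators.heatExtension (v s) (t - s) x - oseenDuhamel 1 s v v t x)
    (hdiv : ∀ t < 0, VectorCalculus.IsDivFree (v t))
    (hDax : ∀ t < 0, ∀ x : EuclideanSpace ℝ (Fin 3), ‖v t x‖ ≤ D / (cylRadius x + Real.sqrt (-t)))
    (hsign : ∀ s < 0, ∀ y, 0 ≤ ⟪curl (v s) y, (EuclideanSpace.single (2 : Fin 3) (1 : ℝ))⟫_ℝ)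
    (hcone : GlobalCone v) :
    ∀ s < 0, ∀ y, ⟪curl (v s) y, (EuclideanSpace.single (2 : Fin 3) (1 : ℝ))⟫_ℝ = 0 := by
  have hsm : IsSmoothSpaceTimeOn (Iio (0 : ℝ)) v := isSmoothSpaceTimeOn_of_class hrate hcont hmild hdiv
  have hD0 : 0 ≤ D := axisBound_nonneg hDax
  obtain ⟨K, hK0, hK⟩ := tiltCirc_le_of_globalCone hcone
  refine inner_curl_e3_eq_zero_of_axisTypeI_remainder_le C D (2 * (1 + K) * D) v hrate hcont hmild hdiv hDax hsign
    (by positivity) fun s hs r hr z => ?_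
  have h := abs_remainder_le_of_cone hsm hDax hsign hK hs hr z
  simpa only [mul_div_assoc] using h

end Summit.NavierStokesRegularity.NavierStokesRegularity.Theorems.HalfSpaceWindowDoorCirculationCarryingRigidityEddyTorqueStrata

end
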